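import Mathlib
import Summits.Ventures.PercRepro.TriangleCapTwoTrianglesC
import Summits.Ventures.PercRepro.TriangleCapOneTriangleEight
import Summits.Ventures.PercRepro.TriangleCapOneBelowDiagonal

/-!
# PercRepro — THE DENSE-CORNER STABILITY FOR `k ≥ 8`, AND THE CELLS ONE BELOW THE DIAGONAL FROM `k = 8` ON
(p3, gen 35; part 35d)

* **`stability_of_two_triangles_eight`** — a `K₄⁻`-free graph on `k ≥ 8` vertices with `m ≥ 2k − 3` edges and two
  triangles `u v w`, `a b c` (`a ∉ {u, v, w}`) has `Σ_v d(v)² + (k − 2) ≤ m·k`: a third triangle with a vertex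
  off both gives `|T₃| ≥ 18` and the envelope pays; otherwise every triangle vertex lies in
  `S = {u, v, w, a, b, c}`, and either a triangle has an outer vertex (`Σ_{T₃} |outer| ≥ 6`), or some vertex
  off `S` is adjacent to one vertex of each triangle and the two pairs are far from the other triangle
  (`Σ_{codeg = 0} deficit ≥ 4`), or every vertex off `S` hangs on the shared vertex and `m ≤ k + 1 < 2k − 3`;
* **`dense_stability_eight`** — THE DENSE-CORNER STABILITY FOR `k ≥ 8`: every `K₄⁻`-free graph on `k ≥ 8`
  vertices with `m ≥ 2k − 3` edges that is not complete bipartite spanning has `Σ_v d(v)² + (k − 2) ≤ m·k`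
  (gen 34 had `k ≥ 10`; the one-triangle case is `one_triangle_stability_eight`);
* **`one_below_diagonal_exact_eight`** — for `k ≥ 8` every cell one below the diagonal of the dense corner is
  exact, `(m − 1)(k − 2)/2` by `K_{a,k−a}` minus an edge; `one_below_diagonal_values`: the three new census cells
  `(8,14) 39 · (9,17) 56 · (9,19) 63` (`cell_eight_fourteen`, `cell_nine_seventeen`, `cell_nine_nineteen`).

Axioms: standard.
-/

namespace PercRepro

namespace TriangleCap

namespace C047

open Finset

variable {V : Type*} [Fintype V] [DecidableEq V]

/-- **TWO TRIANGLES PAY THE GAP FOR `k ≥ 8` IN THE DENSE CORNER.** -/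
theorem stability_of_two_triangles_eight (D : SimpleGraph V) [DecidableRel D.Adj] (hK : K4mFree D)
    (hk : 8 ≤ Fintype.card V) (hm : 2 * Fintype.card V ≤ D.edgeFinset.card + 3) {u v w a b c : V}
    (huv : D.Adj u v) (huw : D.Adj u w) (hvw : D.Adj v w) (hab : D.Adj a b) (hac : D.Adj a c)
    (hbc : D.Adj b c) (ha : ¬ (a = u ∨ a = v ∨ a = w)) :
    ∑ v, deg D v * deg D v + (Fintype.card V - 2) ≤ D.edgeFinset.card * Fintype.card V := by
  have h12 := twelve_le_card_triangles3 D huv huw hvw hab hac hbc ha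
  by_cases h3 : ∃ x y z, D.Adj x y ∧ D.Adj x z ∧ D.Adj y z ∧
      ¬ (x = u ∨ x = v ∨ x = w ∨ x = a ∨ x = b ∨ x = c)
  · obtain ⟨x, y, z, hxy, hxz, hyz, hx⟩ := h3
    exact stability_of_triangle_bounds D hK hk h12
      (Or.inl (eighteen_le_card_triangles3 D huv huw hvw hab hac hbc ha hxy hxz hyz hx))
  · have hS : ∀ x y z, D.Adj x y → D.Adj x z → D.Adj y z →
        x = u ∨ x = v ∨ x = w ∨ x = a ∨ x = b ∨ x = c := by
      intro x y z h1 h2 h3'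
      by_contra hx
      exact h3 ⟨x, y, z, h1, h2, h3', hx⟩
    by_cases hO1 : outer D u v w = ∅
    · by_cases hO2 : outer D a b c = ∅
      · rcases two_triangles_no_outer D hK (by omega) huv huw hvw hab hac hbc ha hS hO1 hO2 with h4 | hm'
        · exact stability_of_triangle_bounds D hK hk h12 (Or.inr (Or.inr h4))
        · exfalso
          omega
      · obtain ⟨x, hx⟩ := nonempty_iff_ne_empty.mpr hO2
        exact stability_of_triangle_bounds D hK hk h12 (Or.inr (Or.inl (six_le_sum_outer D hab hac hbc hx)))
    · obtain ⟨x, hx⟩ := nonempty_iff_ne_empty.mpr hO1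
      exact stability_of_triangle_bounds D hK hk h12 (Or.inr (Or.inl (six_le_sum_outer D huv huw hvw hx)))

/-- **THE DENSE-CORNER STABILITY (`k ≥ 8`).** -/
theorem dense_stability_eight (D : SimpleGraph V) [DecidableRel D.Adj] (hK : K4mFree D)
    (hk : 8 ≤ Fintype.card V) (hm : 2 * Fintype.card V ≤ D.edgeFinset.card + 3)
    (hnot : ¬ ∃ A : Finset V, ∀ x y, D.Adj x y ↔ Xor (x ∈ A) (y ∈ A)) :
    ∑ v, deg D v * deg D v + (Fintype.card V - 2) ≤ D.edgeFinset.card * Fintype.card V := by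
  by_cases hfree : D.CliqueFree 3
  · exact mantel_stability D hfree hnot
  · obtain ⟨S, hS⟩ := not_forall.mp hfree
    have hS' := not_not.mp hS
    rw [SimpleGraph.is3Clique_iff] at hS'
    obtain ⟨u, v, w, huv, huw, hvw, -⟩ := hS'
    by_cases hT : ∀ a b c, D.Adj a b → D.Adj a c → D.Adj b c → a = u ∨ a = v ∨ a = w
    · exact one_triangle_stability_eight D hK hk huv huw hvw hT hm
    · simp only [not_forall, not_or] at hT
      obtain ⟨a, b, c, hab, hac, hbc, hau, hav, haw⟩ := hT
      exact stability_of_two_triangles_eight D hK hk hm huv huw hvw hab hac hbc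
        (fun h => by rcases h with h | h | h; exact hau h; exact hav h; exact haw h)

/-- The cherry form: `2·Σ_v C(d(v), 2) + 2m + (k − 2) ≤ m·k` for `k ≥ 8`. -/
theorem dense_stability_cherries_eight (D : SimpleGraph V) [DecidableRel D.Adj] (hK : K4mFree D)
    (hk : 8 ≤ Fintype.card V) (hm : 2 * Fintype.card V ≤ D.edgeFinset.card + 3)
    (hnot : ¬ ∃ A : Finset V, ∀ x y, D.Adj x y ↔ Xor (x ∈ A) (y ∈ A)) :
    2 * cherries D + 2 * D.edgeFinset.card + (Fintype.card V - 2) ≤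
      D.edgeFinset.card * Fintype.card V := by
  have h := dense_stability_eight D hK hk hm hnot
  rw [← two_mul_cherries_add, sum_deg_eq] at h
  exact h

/-- **ONE BELOW THE DIAGONAL, `K₄⁻`-FREE, EXACT (`k ≥ 8`):** for `1 ≤ a < k` with `m = a(k−a) − 1 ≥ 2k − 3` not
of the form `a′(k − a′)`, the maximum of `2·Σ_v C(d(v), 2)` over `K₄⁻`-free graphs with `m` edges on `k` vertices
is `(m − 1)(k − 2)`, attained by `K_{a,k−a}` minus an edge. -/
theorem one_below_diagonal_exact_eight (k a : ℕ) (hk : 8 ≤ k) (ha : 1 ≤ a) (hak : a < k)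
    (hdense : 2 * k ≤ a * (k - a) - 1 + 3)
    (hm : ∀ a', a' ≤ k → a * (k - a) - 1 ≠ a' * (k - a')) :
    (∀ (D : SimpleGraph (Fin k)) [DecidableRel D.Adj], K4mFree D →
        D.edgeFinset.card = a * (k - a) - 1 → 2 * cherries D ≤ (a * (k - a) - 2) * (k - 2)) ∧
      ∃ (D : SimpleGraph (Fin k)) (_ : DecidableRel D.Adj), K4mFree D ∧
        D.edgeFinset.card = a * (k - a) - 1 ∧ 2 * cherries D = (a * (k - a) - 2) * (k - 2) := by
  have hka : 2 ≤ a * (k - a) := by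
    have h0 := hm 0 (Nat.zero_le _)
    simp only [Nat.zero_mul] at h0
    omega
  obtain ⟨m, hmm⟩ : ∃ m, a * (k - a) = m + 2 := ⟨a * (k - a) - 2, by omega⟩
  have e1 : a * (k - a) - 1 = m + 1 := by omega
  have e2 : a * (k - a) - 2 = m := by omega
  rw [e1, e2]
  obtain ⟨t, ht⟩ : ∃ t, k = t + 2 := ⟨k - 2, by omega⟩
  have e3 : k - 2 = t := by omega
  rw [e3]
  refine ⟨fun D _ hK hD => ?_, bipMinus k a, inferInstance, k4mFree_bipMinus k a,
    by have := card_edges_bipMinus k a ha hak; omega, ?_⟩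
  · have hnot : ¬ ∃ A : Finset (Fin k), ∀ x y, D.Adj x y ↔ Xor (x ∈ A) (y ∈ A) := by
      rintro ⟨A, hA⟩
      have := card_edges_eq_of_complete_bipartite D A hA
      rw [Fintype.card_fin, hD] at this
      exact hm A.card (by have := card_le_univ A; rw [Fintype.card_fin] at this; exact this)
        (by rw [e1]; exact this)
    have h := dense_stability_cherries_eight D hK (by rw [Fintype.card_fin]; exact hk)
      (by rw [Fintype.card_fin, hD]; omega) hnot
    rw [Fintype.card_fin, hD, e3] at h
    have hk' : (m + 1) * k = m * t + t + 2 * (m + 1) := by rw [ht]; ring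
    rw [hk'] at h
    omega
  · have h := two_mul_cherries_bipMinus k a ha hak
    rw [hmm, e3] at h
    have hk' : (m + 2) * t = m * t + 2 * t := by ring
    rw [hk'] at h
    omega

/-- The three census cells one below the diagonal at `k = 8, 9`: `(8,14) 39 · (9,17) 56 · (9,19) 63`. -/
theorem one_below_diagonal_values :
    (3 * (8 - 3) - 2) * (8 - 2) / 2 = 39 ∧ (3 * (9 - 3) - 2) * (9 - 2) / 2 = 56 ∧
      (4 * (9 - 4) - 2) * (9 - 2) / 2 = 63 := by
  decide

/-- **THE CELL `(8, 14)` IS EXACT:** the `K₄⁻`-free cherry maximum with `14` edges on `8` vertices is `39`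
(`2 · 39 = 78`), by `K_{3,5}` minus an edge. -/
theorem cell_eight_fourteen :
    (∀ (D : SimpleGraph (Fin 8)) [DecidableRel D.Adj], K4mFree D →
        D.edgeFinset.card = 14 → 2 * cherries D ≤ 78) ∧
      ∃ (D : SimpleGraph (Fin 8)) (_ : DecidableRel D.Adj), K4mFree D ∧
        D.edgeFinset.card = 14 ∧ 2 * cherries D = 78 := by
  have h := one_below_diagonal_exact_eight 8 3 (by norm_num) (by norm_num) (by norm_num) (by norm_num)
    (by decide)
  norm_num at h
  exact h

/-- **THE CELL `(9, 17)` IS EXACT:** the `K₄⁻`-free cherry maximum with `17` edges on `9` vertices is `56`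
(`2 · 56 = 112`), by `K_{3,6}` minus an edge. -/
theorem cell_nine_seventeen :
    (∀ (D : SimpleGraph (Fin 9)) [DecidableRel D.Adj], K4mFree D →
        D.edgeFinset.card = 17 → 2 * cherries D ≤ 112) ∧
      ∃ (D : SimpleGraph (Fin 9)) (_ : DecidableRel D.Adj), K4mFree D ∧
        D.edgeFinset.card = 17 ∧ 2 * cherries D = 112 := by
  have h := one_below_diagonal_exact_eight 9 3 (by norm_num) (by norm_num) (by norm_num) (by norm_num)
    (by decide)
  norm_num at h
  exact h

/-- **THE CELL `(9, 19)` IS EXACT:** the `K₄⁻`-free cherry maximum with `19` edges on `9` vertices is `63`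
(`2 · 63 = 126`), by `K_{4,5}` minus an edge — the same value as the diagonal cell `(9, 18)`. -/
theorem cell_nine_nineteen :
    (∀ (D : SimpleGraph (Fin 9)) [DecidableRel D.Adj], K4mFree D →
        D.edgeFinset.card = 19 → 2 * cherries D ≤ 126) ∧
      ∃ (D : SimpleGraph (Fin 9)) (_ : DecidableRel D.Adj), K4mFree D ∧
        D.edgeFinset.card = 19 ∧ 2 * cherries D = 126 := by
  have h := one_below_diagonal_exact_eight 9 4 (by norm_num) (by norm_num) (by norm_num) (by norm_num)
    (by decide)
  norm_num at h
  exact h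

end C047

end TriangleCap

end PercRepro
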